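import Summits.KontsevichZagierPeriods.Zeta5Search.Certificates.TwoTaleTelescopeARFin

/-!
# (bmiss)@Ω — cert-2's certificate atoms of direction `a`, side `R`, evaluated (cell `pub-zeta5`, cert-1 gen 4)

HONEST FRAMING: systematic search; recurrence certificates; no irrationality claim unless certified. Pure algebra over `ℚ`.

Values of the opaque atoms of `Certificates.TwoTaleTelescope.telescope_a_R` at `t = u/2` (`u` the lattice variable): the Γ-ratio
linear-form products (with their `t`-free factors `(f−a+e−j)`), and the cubic certificate numerator `x_R(t)` as a polynomial in the
LATTICE variable, `xPolyARu` (`eval_xPolyARu : (xPolyARu …).eval (u + 2s) = polyTN xAR s … (u/2)`).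
-/

noncomputable section

open Polynomial
open Summit.KontsevichZagierPeriods.Zeta5Search.Certificates.TwoTaleTelescope

namespace Summit.KontsevichZagierPeriods.Zeta5Search.TwoTaleOmega

/-- Value of cert-2's atom `lprod numAR1` at `t = u/2`. -/
theorem numAR1_eval (a b e f g u : ℚ) : lprod numAR1 a b e f g (u / 2) = (a - b + g + u) * (a + u / 2) := by
  simp only [lprod_cons, lprod_nil, lval, numAR1, List.getD_cons_zero, List.getD_cons_succ]
  push_cast; ring

/-- Value of cert-2's atom `lprod numAR2` at `t = u/2`. -/
theorem numAR2_eval (a b e f g u : ℚ) : lprod numAR2 a b e f g (u / 2) = (a - b + g + u) * (a - b + g + u + 1) * (a + u / 2) * (a + u / 2 + 1) := by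
  simp only [lprod_cons, lprod_nil, lval, numAR2, List.getD_cons_zero, List.getD_cons_succ]
  push_cast; ring

/-- Value of cert-2's atom `lprod numAR3` at `t = u/2`. -/
theorem numAR3_eval (a b e f g u : ℚ) : lprod numAR3 a b e f g (u / 2) = (a - b + g + u) * (a - b + g + u + 1) * (a - b + g + u + 2) * (a + u / 2) * (a + u / 2 + 1) * (a + u / 2 + 2) := by
  simp only [lprod_cons, lprod_nil, lval, numAR3, List.getD_cons_zero, List.getD_cons_succ]
  push_cast; ring

/-- Value of cert-2's atom `lprod denAR1` at `t = u/2`. -/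
theorem denAR1_eval (a b e f g u : ℚ) : lprod denAR1 a b e f g (u / 2) = (-a + e + f - 1) * (a + u + 1) * (a - b + u / 2 + 1) := by
  simp only [lprod_cons, lprod_nil, lval, denAR1, List.getD_cons_zero, List.getD_cons_succ]
  push_cast; ring

/-- Value of cert-2's atom `lprod denAR2` at `t = u/2`. -/
theorem denAR2_eval (a b e f g u : ℚ) : lprod denAR2 a b e f g (u / 2) = (-a + e + f - 1) * (-a + e + f - 2) * (a + u + 1) * (a + u + 2) * (a - b + u / 2 + 1) * (a - b + u / 2 + 2) := by
  simp only [lprod_cons, lprod_nil, lval, denAR2, List.getD_cons_zero, List.getD_cons_succ]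
  push_cast; ring

/-- Value of cert-2's atom `lprod denAR3` at `t = u/2`. -/
theorem denAR3_eval (a b e f g u : ℚ) : lprod denAR3 a b e f g (u / 2) = (-a + e + f - 1) * (-a + e + f - 2) * (-a + e + f - 3) * (a + u + 1) * (a + u + 2) * (a + u + 3) * (a - b + u / 2 + 1) * (a - b + u / 2 + 2) * (a - b + u / 2 + 3) := by
  simp only [lprod_cons, lprod_nil, lval, denAR3, List.getD_cons_zero, List.getD_cons_succ]
  push_cast; ring

/-- Value of cert-2's atom `lprod tnAR` at `t = u/2`. -/
theorem tnAR_eval (a b e f g u : ℚ) : lprod tnAR a b e f g (u / 2) = (a - b + g + u) * (a - b + g + u + 1) * (a + u / 2) * (e + u / 2) * (f + u / 2) := by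
  simp only [lprod_cons, lprod_nil, lval, tnAR, List.getD_cons_zero, List.getD_cons_succ]
  push_cast; ring

/-- Value of cert-2's atom `lprod tdAR` at `t = u/2`. -/
theorem tdAR_eval (a b e f g u : ℚ) : lprod tdAR a b e f g (u / 2) = (a + u + 1) * (a + u + 2) * (a - b + u / 2 + 1) * (e + f + u / 2) * (g + u / 2) := by
  simp only [lprod_cons, lprod_nil, lval, tdAR, List.getD_cons_zero, List.getD_cons_succ]
  push_cast; ring

/-- Value of cert-2's atom `lprod cnumAR` at `t = u/2`. -/
theorem cnumAR_eval (a b e f g u : ℚ) : lprod cnumAR a b e f g (u / 2) = (e + f + u / 2 - 1) * (g + u / 2 - 1) * (a + u + 2) * (a + u + 3) * (a - b + u / 2 + 3) := by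
  simp only [lprod_cons, lprod_nil, lval, cnumAR, List.getD_cons_zero, List.getD_cons_succ]
  push_cast; ring

/-- Value of cert-2's atom `lprod cnumSAR` at `t = u/2`. -/
theorem cnumSAR_eval (a b e f g u : ℚ) : lprod cnumSAR a b e f g (u / 2) = (e + f + u / 2) * (g + u / 2) * (a + u + 4) * (a + u + 5) * (a - b + u / 2 + 4) := by
  simp only [lprod_cons, lprod_nil, lval, cnumSAR, List.getD_cons_zero, List.getD_cons_succ]
  push_cast; ring

/-- Value of cert-2's atom `lprod cdenAR` at `t = u/2`. -/
theorem cdenAR_eval (a b e f g u : ℚ) : lprod cdenAR a b e f g (u / 2) = (a + u + 1) * (a - b + u / 2 + 1) * (-a + e + f - 1) * (a + u + 2) * (a - b + u / 2 + 2) * (-a + e + f - 2) * (a + u + 3) * (a - b + u / 2 + 3) * (-a + e + f - 3) := by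
  simp only [lprod_cons, lprod_nil, lval, cdenAR, List.getD_cons_zero, List.getD_cons_succ]
  push_cast; ring

/-- Value of cert-2's atom `lprod cdenSAR` at `t = u/2`. -/
theorem cdenSAR_eval (a b e f g u : ℚ) : lprod cdenSAR a b e f g (u / 2) = (a + u + 3) * (a - b + u / 2 + 2) * (-a + e + f - 1) * (a + u + 4) * (a - b + u / 2 + 3) * (-a + e + f - 2) * (a + u + 5) * (a - b + u / 2 + 4) * (-a + e + f - 3) := by
  simp only [lprod_cons, lprod_nil, lval, cdenSAR, List.getD_cons_zero, List.getD_cons_succ]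
  push_cast; ring

/-- The `j`-th coefficient `x_j(a,b,e,f,g)` of the side-`R` certificate numerator of direction `a`. -/
def xARc (j : ℕ) (a b e f g : ℚ) : ℚ := spvalC (xAR.getD j []) a b e f g

/-- The side-`R` certificate numerator of direction `a`, `x_R(t) = Σ_{j<4} x_j t^j`, as a polynomial in the lattice variable
`u = 2t`: `Σ_j (x_j / 2^j) u^j`. -/
def xPolyARu (a b e f g : ℚ) : ℚ[X] :=
  C (xARc 0 a b e f g) + C (xARc 1 a b e f g / 2) * X + C (xARc 2 a b e f g / 4) * X ^ 2 + C (xARc 3 a b e f g / 8) * X ^ 3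

/-- `x_R` in the lattice variable at `u + 2s` is cert-2's atom `polyTN xAR s` at `t = u/2`. -/
theorem eval_xPolyARu (s : ℤ) (a b e f g u : ℚ) : (xPolyARu a b e f g).eval (u + 2 * s) = polyTN xAR s a b e f g (u / 2) := by
  have hl : xAR.length = 4 := rfl
  simp only [polyTN, hl, xPolyARu, xARc, eval_add, eval_mul, eval_C, eval_X, eval_pow]
  simp [List.range_succ]
  ring

/-- `deg x_R ≤ 3`. -/
theorem natDegree_xPolyARu_le (a b e f g : ℚ) : (xPolyARu a b e f g).natDegree ≤ 3 := by
  unfold xPolyARu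
  refine (natDegree_add_le _ _).trans (max_le ((natDegree_add_le _ _).trans (max_le ((natDegree_add_le _ _).trans
    (max_le ?_ ?_)) ?_)) ?_)
  · exact (natDegree_C _).le.trans (by norm_num)
  · exact (natDegree_C_mul_le _ _).trans (natDegree_X_le.trans (by norm_num))
  · exact (natDegree_C_mul_le _ _).trans ((natDegree_pow_le).trans (by simp))
  · exact (natDegree_C_mul_le _ _).trans ((natDegree_pow_le).trans (by simp))

end Summit.KontsevichZagierPeriods.Zeta5Search.TwoTaleOmega

end
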